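import Literature.NumberTheory.GaloisRepresentations.DiscreteRepFrobenius
import Literature.NumberTheory.GaloisRepresentations.FramedRepEquivConj
import Literature.NumberTheory.Automorphic.ChebotarevArtinRepHolds
import Literature.RepresentationTheory.Semisimple.IrreducibleOfCharpoly
import HarnessLib

/-!
# Mod-`λ` rigidity: an IRREDUCIBLE Galois representation over a discrete field is determined up
# to conjugation by its Frobenius characteristic polynomials (Darmon–Diamond–Taylor 1995,
# Prop. 2.6; Serre 1968, I-2.3; Deligne–Serre 1974, Lemme 3.2)

Topic `Literature/NumberTheory/GaloisRepresentations`; a *proofs* file (theorems only, no named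
fact, no `sorry`), sibling of `DiscreteRepFrobenius` (Deligne–Serre, *Formes modulaires de poids 1*,
§3.1 (a)–(b) and Lemme 3.2, p. 513: semisimple representations over a DISCRETE field with the same
Frobenius characteristic polynomials at almost all places are isomorphic) and of
`FramedRepEquivConj` (equivalent framed representations are conjugate).  The refinement proved
here is the form in which the statement is used for residual representations
(Darmon–Diamond–Taylor, *Fermat's Last Theorem*, Prop. 2.6 (c), p. 46 of the CDM version: "if
`ρ̄` is irreducible … then `ρ̄' ∼ ρ̄`"; Serre, *Abelian `ℓ`-adic representations*, I-2.3, Remark):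
**only ONE of the two representations is assumed irreducible, nothing is assumed about the
other**, and the conclusion is an equality `ρ₂ = A ρ₁ A⁻¹` of framed representations.

* `FramedGaloisRep.isIrreducible_of_hasFrobCharpolyAt_eventually` — if `ρ₁` is irreducible and
  `ρ₁, ρ₂ : Γ_K → GL_n(k)` (continuous, `k` a field with the discrete topology) are unramified with
  a common characteristic polynomial of Frobenius at all but finitely many places, then `ρ₂` is
  irreducible: the characteristic polynomials agree on all of `Γ_K`
  (`FramedGaloisRep.charpoly_eq_of_hasFrobCharpolyAt_eventually`, Čebotarev — PROVED in the tree,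
  `Automorphic.chebotarev_artinRep_holds`) and irreducibility only depends on the characteristic
  polynomials (`Literature.RepresentationTheory.Semisimple.isIrreducible_of_charpoly_eq`:
  semisimplification of the diagonal blocks of a stable flag + Brauer–Nesbitt over an arbitrary
  field, Bourbaki *Algèbre* VIII § 20 n° 6).
* `FramedGaloisRep.exists_eq_conj_of_hasFrobCharpolyAt_eventually_of_isIrreducible` — hence
  (both now irreducible, so semisimple) `ρ₂ ≅ ρ₁` by Lemme 3.2
  (`nonempty_equiv_of_hasFrobCharpolyAt_eventually_of_discrete`) and `ρ₂ = A ρ₁ A⁻¹`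
  (`FramedRep.exists_eq_conj_of_equiv`); finite-exceptional-set form `…_of_finite_…`.
* `FramedGaloisRep.exists_eq_conj_of_hasFrobCharpolyAt_of_not_dvd` — the same over `ℚ` with the
  exceptional places written as "`p_v ∣ N`" for an integer `N ≠ 0` (the places of `ℚ` being
  indexed by the primes, `Rat.HeightOneSpectrum.primesEquiv`); this is VERBATIM the body of the
  route item X35 `FramedRepConjugateOfCongruentFrobenius` (stmt-BirchSwinnertonDyer-23869) of
  `Summits/BirchSwinnertonDyer/…/Theses/TameQuarticManinParity.lean`, in rank `n` (the item is
  `n = 2`).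

Not here: coefficient fields that are not discrete (`ℓ`-adic fields: `LAdicRepFrobenius`,
`SorensenPatching.exists_conj_of_trace_eq` is the characteristic-`0` trace twin).

## References

* H. Darmon, F. Diamond, R. Taylor, *Fermat's Last Theorem*, in: Current Developments in
  Mathematics 1995, International Press, Prop. 2.6 and §2.1. [DarmonDiamondTaylor1995]
* J.-P. Serre, *Abelian ℓ-adic representations and elliptic curves*, Benjamin 1968, Ch. I §2.3.
  [SerreAbelianLadic1968]
* P. Deligne, J.-P. Serre, *Formes modulaires de poids 1*, Ann. Sci. ÉNS (4) 7 (1974), 507–530,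
  §3.1 and Lemme 3.2, Remarque 3.3 (p. 513). [DeligneSerreASENS1974]
* N. Bourbaki, *Algèbre* VIII (2012), § 20 n° 6, Thm. 2, Cor. 1 (p. 378). [BourbakiAlgebreVIII2012]
-/

noncomputable section

open scoped NumberField MatrixGroups
open IsDedekindDomain

namespace Literature.NumberTheory.GaloisRepresentations

section Prelim

variable {K : Type} [Field K] {k : Type*} [Field k] [TopologicalSpace k] {n : ℕ}

/-- The matrix characteristic polynomial `FramedRep.charpoly ρ σ` is the one of
`ρ.toMonoidHom σ`. [folklore] -/
private theorem FramedGaloisRep.charpoly_eq_toMonoidHom (ρ : FramedGaloisRep K k n)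
    (σ : Field.absoluteGaloisGroup K) :
    FramedRep.charpoly ρ σ =
      ((ρ.toMonoidHom σ : GL (Fin n) k) : Matrix (Fin n) (Fin n) k).charpoly := rfl

/-- An irreducible framed representation over a field is semisimple (a simple lattice of
subrepresentations is complemented). [folklore] -/
private theorem FramedGaloisRep.isSemisimple_of_isIrreducible' [IsTopologicalRing k]
    (ρ : FramedGaloisRep K k n) (h : FramedRep.IsIrreducible ρ) : ρ.toGaloisRep.IsSemisimple := by
  haveI : Representation.IsIrreducible ρ.toGaloisRep.toRepresentation := h
  change ComplementedLattice _
  infer_instance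

end Prelim

section Rigidity

variable {K : Type} [Field K] [NumberField K] {k : Type*} [Field k] [TopologicalSpace k]
  [DiscreteTopology k] {n : ℕ}

/-- **Irreducibility is determined by the Frobenius characteristic polynomials (discrete
coefficients).**  Let `k` be a field with the discrete topology and `ρ₁, ρ₂ : Γ_K → GL_n(k)`
continuous, with `ρ₁` irreducible; if at all but finitely many finite places both are unramified
with a common characteristic polynomial of arithmetic Frobenius, then `ρ₂` is irreducible.  Proof:
the characteristic polynomials of `ρ₁(σ)`, `ρ₂(σ)` agree for every `σ` (Čebotarev density,
`FramedGaloisRep.charpoly_eq_of_hasFrobCharpolyAt_eventually`, with the tree's proved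
`Automorphic.chebotarev_artinRep_holds`), and a representation with the characteristic polynomials
of an irreducible one is irreducible (`isIrreducible_of_charpoly_eq`, Brauer–Nesbitt over any
field).  (Darmon–Diamond–Taylor 1995, §2.1: "`ρ̄^{ss}` irreducible ⇒ `ρ̄` irreducible".)
[cite: DarmonDiamondTaylor1995, §2.1 and Prop. 2.6] [cite: BourbakiAlgebreVIII2012, VIII § 20 n° 6, Thm. 2, Cor. 1] -/
theorem FramedGaloisRep.isIrreducible_of_hasFrobCharpolyAt_eventually
    (ρ₁ ρ₂ : FramedGaloisRep K k n) (h₁ : FramedRep.IsIrreducible ρ₁)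
    (h : ∀ᶠ v : HeightOneSpectrum (𝓞 K) in Filter.cofinite,
      ρ₁.IsUnramifiedAt v ∧ ρ₂.IsUnramifiedAt v ∧
        ∃ P : Polynomial k, ρ₁.HasFrobCharpolyAt v P ∧ ρ₂.HasFrobCharpolyAt v P) :
    FramedRep.IsIrreducible ρ₂ := by
  have hall := FramedGaloisRep.charpoly_eq_of_hasFrobCharpolyAt_eventually
    Automorphic.chebotarev_artinRep_holds ρ₁ ρ₂ h
  exact Literature.RepresentationTheory.Semisimple.isIrreducible_of_charpoly_eq
    ρ₂.toMonoidHom ρ₁.toMonoidHom (fun σ ↦ by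
      rw [← FramedGaloisRep.charpoly_eq_toMonoidHom, ← FramedGaloisRep.charpoly_eq_toMonoidHom,
        hall σ]) h₁

/-- **Mod-`λ` rigidity** (Darmon–Diamond–Taylor 1995, Prop. 2.6; Serre 1968, I-2.3; Deligne–Serre
1974, Lemme 3.2 with only ONE side assumed irreducible).  Let `k` be a field with the discrete
topology, `ρ₁, ρ₂ : Γ_K → GL_n(k)` continuous framed representations of the absolute Galois group
of a number field `K`, `ρ₁` irreducible (over `k`).  If at all but finitely many finite places `v`
both are unramified with a common characteristic polynomial of arithmetic Frobenius, then
`ρ₂ = A ρ₁ A⁻¹` for some `A ∈ GL_n(k)`.  Proof: `ρ₂` is irreducible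
(`isIrreducible_of_hasFrobCharpolyAt_eventually`), irreducible representations are semisimple, so
Lemme 3.2 (`nonempty_equiv_of_hasFrobCharpolyAt_eventually_of_discrete`: Čebotarev + Brauer–Nesbitt)
gives an equivalence `ρ₁ ≃ ρ₂`, whose matrix conjugates (`FramedRep.exists_eq_conj_of_equiv`).
[cite: DarmonDiamondTaylor1995, Prop. 2.6] [cite: DeligneSerreASENS1974, Lemme 3.2 (p. 513)] -/
theorem FramedGaloisRep.exists_eq_conj_of_hasFrobCharpolyAt_eventually_of_isIrreducible
    (ρ₁ ρ₂ : FramedGaloisRep K k n) (h₁ : FramedRep.IsIrreducible ρ₁)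
    (h : ∀ᶠ v : HeightOneSpectrum (𝓞 K) in Filter.cofinite,
      ρ₁.IsUnramifiedAt v ∧ ρ₂.IsUnramifiedAt v ∧
        ∃ P : Polynomial k, ρ₁.HasFrobCharpolyAt v P ∧ ρ₂.HasFrobCharpolyAt v P) :
    ∃ A : GL (Fin n) k, ρ₂ = FramedRep.conj A ρ₁ := by
  have h₂ := FramedGaloisRep.isIrreducible_of_hasFrobCharpolyAt_eventually ρ₁ ρ₂ h₁ h
  obtain ⟨e⟩ := FramedGaloisRep.nonempty_equiv_of_hasFrobCharpolyAt_eventually_of_discrete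
    Automorphic.chebotarev_artinRep_holds ρ₁ ρ₂
    (FramedGaloisRep.isSemisimple_of_isIrreducible' ρ₁ h₁)
    (FramedGaloisRep.isSemisimple_of_isIrreducible' ρ₂ h₂) h
  exact FramedRep.exists_eq_conj_of_equiv ρ₁ ρ₂ e

/-- Finite-exceptional-set form of
`exists_eq_conj_of_hasFrobCharpolyAt_eventually_of_isIrreducible` (Deligne–Serre, Remarque 3.3:
the primes not dividing a given `N`; Darmon–Diamond–Taylor Prop. 2.6: "unramified outside a finite
set `S`"). [cite: DarmonDiamondTaylor1995, Prop. 2.6] -/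
theorem FramedGaloisRep.exists_eq_conj_of_hasFrobCharpolyAt_of_finite_of_isIrreducible
    {S : Set (HeightOneSpectrum (𝓞 K))} (hS : S.Finite)
    (ρ₁ ρ₂ : FramedGaloisRep K k n) (h₁ : FramedRep.IsIrreducible ρ₁)
    (hST : ∀ v ∉ S, ρ₁.IsUnramifiedAt v ∧ ρ₂.IsUnramifiedAt v ∧
      ∃ P : Polynomial k, ρ₁.HasFrobCharpolyAt v P ∧ ρ₂.HasFrobCharpolyAt v P) :
    ∃ A : GL (Fin n) k, ρ₂ = FramedRep.conj A ρ₁ :=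
  FramedGaloisRep.exists_eq_conj_of_hasFrobCharpolyAt_eventually_of_isIrreducible ρ₁ ρ₂ h₁
    (Filter.mem_of_superset hS.compl_mem_cofinite fun v hv ↦ hST v hv)

end Rigidity

section Rat

variable {k : Type*} [Field k] [TopologicalSpace k] [DiscreteTopology k] {n : ℕ}

/-- The finite places of `ℚ` whose residue characteristic divides a non-zero integer `N` form a
finite set (they correspond to the prime divisors of `N` under
`Rat.HeightOneSpectrum.primesEquiv`). [folklore] -/
private theorem Rat.finite_setOf_primesEquiv_dvd {N : ℕ} (hN : N ≠ 0) :
    {v : HeightOneSpectrum (𝓞 ℚ) |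
      ((Rat.HeightOneSpectrum.primesEquiv (R := 𝓞 ℚ) v : Nat.Primes) : ℕ) ∣ N}.Finite := by
  have hfin : {p : ℕ | p ∣ N}.Finite :=
    (Set.finite_Iic N).subset fun p hp ↦ Nat.le_of_dvd (Nat.pos_of_ne_zero hN) hp
  refine (hfin.preimage (f := fun v : HeightOneSpectrum (𝓞 ℚ) ↦
    ((Rat.HeightOneSpectrum.primesEquiv (R := 𝓞 ℚ) v : Nat.Primes) : ℕ)) ?_).subset
    fun v hv ↦ hv
  exact (Nat.Primes.coe_nat_injective.comp
    (Rat.HeightOneSpectrum.primesEquiv (R := 𝓞 ℚ)).injective).injOn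

/-- **Mod-`λ` rigidity over `ℚ`, integer-level form** (Darmon–Diamond–Taylor 1995, Prop. 2.6 read
over a discrete field): `k` a field with the discrete topology, `ρ₁, ρ₂ : Γ_ℚ → GL_n(k)` continuous,
`ρ₁` irreducible over `k`, `N ≠ 0`; if at every place `v` with `p_v ∤ N` both are unramified with a
common characteristic polynomial of Frobenius, then `ρ₂ = A ρ₁ A⁻¹` for some `A ∈ GL_n(k)`.  For
`n = 2` this is VERBATIM the route item `FramedRepConjugateOfCongruentFrobenius` (X35,
stmt-BirchSwinnertonDyer-23869) of `Summits/BirchSwinnertonDyer/…/Theses/TameQuarticManinParity`.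
[cite: DarmonDiamondTaylor1995, Prop. 2.6] [cite: DeligneSerreASENS1974, Lemme 3.2 and Remarque 3.3 (p. 513)] -/
theorem FramedGaloisRep.exists_eq_conj_of_hasFrobCharpolyAt_of_not_dvd
    (ρ₁ ρ₂ : FramedGaloisRep ℚ k n) (h₁ : FramedRep.IsIrreducible ρ₁) (N : ℕ) (hN : N ≠ 0)
    (h : ∀ v : HeightOneSpectrum (𝓞 ℚ),
      ¬ ((Rat.HeightOneSpectrum.primesEquiv (R := 𝓞 ℚ) v : Nat.Primes) : ℕ) ∣ N →
        ρ₁.IsUnramifiedAt v ∧ ρ₂.IsUnramifiedAt v ∧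
          ∃ P : Polynomial k, ρ₁.HasFrobCharpolyAt v P ∧ ρ₂.HasFrobCharpolyAt v P) :
    ∃ A : GL (Fin n) k, ρ₂ = FramedRep.conj A ρ₁ :=
  FramedGaloisRep.exists_eq_conj_of_hasFrobCharpolyAt_of_finite_of_isIrreducible
    (Rat.finite_setOf_primesEquiv_dvd hN) ρ₁ ρ₂ h₁ fun v hv ↦ h v hv

/-- The rank-two case over `ℚ`, quantified exactly as the route item X35
`FramedRepConjugateOfCongruentFrobenius` (stmt-BirchSwinnertonDyer-23869) of
`Summits/BirchSwinnertonDyer/…/Theses/TameQuarticManinParity.lean`: its by-name proof is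
`fun k _ _ _ ρ₁ ρ₂ h₁ N hN h ↦ framedRepConjugate_of_congruentFrobenius k ρ₁ ρ₂ h₁ N hN h`.
[cite: DarmonDiamondTaylor1995, Prop. 2.6] -/
theorem framedRepConjugate_of_congruentFrobenius (k : Type) [Field k] [TopologicalSpace k]
    [DiscreteTopology k] (ρ₁ ρ₂ : FramedGaloisRep ℚ k 2) (h₁ : FramedRep.IsIrreducible ρ₁)
    (N : ℕ) (hN : N ≠ 0)
    (h : ∀ v : HeightOneSpectrum (NumberField.RingOfIntegers ℚ),
      ¬ ((Rat.HeightOneSpectrum.primesEquiv v : Nat.Primes) : ℕ) ∣ N →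
        ρ₁.IsUnramifiedAt v ∧ ρ₂.IsUnramifiedAt v ∧
          ∃ P : Polynomial k, ρ₁.HasFrobCharpolyAt v P ∧ ρ₂.HasFrobCharpolyAt v P) :
    ∃ A : Matrix.GeneralLinearGroup (Fin 2) k, ρ₂ = FramedRep.conj A ρ₁ :=
  FramedGaloisRep.exists_eq_conj_of_hasFrobCharpolyAt_of_not_dvd ρ₁ ρ₂ h₁ N hN h

end Rat

end Literature.NumberTheory.GaloisRepresentations

end
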